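import Mathlib.Analysis.Calculus.MeanValue
import Mathlib.Analysis.Calculus.Deriv.MeanValue
import Mathlib.Analysis.SpecialFunctions.Log.Deriv
import Mathlib.Analysis.SpecialFunctions.Pow.Real
import Mathlib.Analysis.Real.Sqrt
import Mathlib.MeasureTheory.Integral.Bochner.Set
import Mathlib.MeasureTheory.Measure.Lebesgue.Basic
import Mathlib.MeasureTheory.Measure.Prod
import Mathlib.MeasureTheory.Function.SpecialFunctions.Basic
import Mathlib.Topology.Algebra.Order.Field
import Mathlib.Tactic.Positivity
import Mathlib.Tactic.FieldSimp
import HarnessLib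

/-!
# Static shells of massless Vlasov matter surrounding a Schwarzschild black hole

Topic `Literature/Geometry/Lorentzian` (definition item `defn-StaticMasslessVlasovShell`, wanted by
route `FinalStateConjecture/PhotonSphereCapacity`, item `CapacityLaw`, as the KINETIC sub-class of the
static, spherically symmetric, anisotropic ODE class quantified there). Real ODE vocabulary only (no
manifolds): the unknowns are the metric exponent `μ` and the Hawking mass `m` as real functions of the
area radius `r > 2M₀`.

## The system (Andréasson 2021, §2–§3)

Static spherically symmetric metric in Schwarzschild coordinates
`ds² = -e^{2μ(r)} dt² + e^{2λ(r)} dr² + r² (dθ² + sin²θ dφ²)`, asymptotic flatness `μ, λ → 0`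
(`r → ∞`), units `c = G = 1`. Massless Vlasov matter is a phase-space density `f = f(r, w, L) ≥ 0`
(`w` the radial momentum, `L` the square of the angular momentum; the mass shell of massless
particles, `p⁰ = |p|`, is built in through the particle energy `ε = ε(r,w,L) = √(w² + L/r²)`), with
matter quantities (energy density, radial and tangential pressure) [(2.5)–(2.7)]
`ρ(r) = π/r² ∫∫ ε f dL dw`, `p(r) = π/r² ∫∫ (w²/ε) f dL dw`, `p_T(r) = π/(2r⁴) ∫∫ (L/ε) f dL dw`
(`w ∈ ℝ`, `L ∈ (0, ∞)`), the reduced field equations [(2.1), (2.2)]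
`e^{-2λ}(2rλ' - 1) + 1 = 8πr²ρ`, `e^{-2λ}(2rμ' + 1) - 1 = 8πr²p`, and the static Vlasov equation
[(2.4)] `(w/ε) ∂_r f - (μ' ε - L/(r³ε)) ∂_w f = 0`, which is solved by any ansatz `f = Φ(E, L)`,
`E := e^{μ} ε` [(2.8)]; the paper uses the polytropic form [(2.9)]
`Φ(E, L) = (E₀ - E)₊^k (L - L₀)₊^l`, `l ≥ 1/2`, `k ≥ 0`, `L₀ > 0`, `E₀ > 0`.
A Schwarzschild black hole of mass `M₀` sits at the centre; with the Hawking mass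
`m(r) = M₀ + ∫_{2M₀}^r 4πs²ρ ds` (`r ≥ 2M₀`) one has `e^{2λ} = (1 - 2m/r)⁻¹` ("a consequence of the
Einstein equation (2.1)", §4), so that (2.1) ⟺ `m' = 4πr²ρ` and (2.2) ⟺
`μ' = (m/r² + 4πrp) e^{2λ} = (m + 4πr³p) / (r(r - 2m))`; `2m/r < 1` throughout (indeed
`Γ = sup 2m/r < 8/9`, [(2.10)] and [A2] there). (The display defining `m` after (2.10) prints
`∫ s²ρ ds` without the factor `4π` — a misprint: §4 uses "`m'(r) = 4πr²ρ`", which is what (2.1) says.)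

**The shell and its radial cut-off (§3).** "Note that the ansatz (2.9) implies that `f = 0` whenever
`E > E₀`. Accordingly we let `f = 0` in the interval `[2M₀, R₀]`", `R₀ > 3M₀` being the largest root of
`(1 - 2M₀/r) L₀/r² = E₀²` (so the ansatz vanishes identically at `r = R₀`; `3M₀` = photon sphere), and
a Schwarzschild exterior is glued at the radius `R₁ > R₀` where the matter quantities vanish again:
"If a Schwarzschild solution is not attached at `r = R₁`, then the ansatz implies that Vlasov matter
will occur again … and the solution is not asymptotically flat. This is a general feature of massless
static solutions … obtained from an ansatz". Hence the steady state IS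
`f(r, w, L) = 1_{[R₀, R₁]}(r) · Φ(e^{μ(r)} ε, L)` together with the **barrier condition** that
`Φ(e^{μ(R)} ε(R, w, L), L) = 0` for all `(w, L)` at `R = R₀` and `R = R₁`: since `E` and `L` are
constant along the characteristics of (2.4), no particle of the ensemble crosses `r = R₀, R₁`, the slab
`R₀ ≤ r ≤ R₁` is invariant for them, and the cut-off `f` is again a function of the invariants, i.e.
a solution of (2.4) (continuous across the two radii). Existence: Theorem 3.5 (any `M₀ ≥ 0`; finite
ADM mass, matter supported in `[R₀, R₁]` with `R₀ > 3M₀`, asymptotically flat), proved via Theorem 3.10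
(`k = 0`, `l = 1/2`, `R₀` large, `R₁ ≤ R₀ + 50δ`, `Γ → 8/9`).

## Contents

* namespace `MasslessVlasov`: `energy r w L = √(w² + L/r²)`; `cutPow a x = x₊^a` (with `x₊^a = 0`
  for `x ≤ 0`, also when `a = 0` — the reading under which "(2.9) implies `f = 0` whenever `E > E₀`"
  holds for `k = 0`); `polytropicAnsatz E₀ L₀ k l = Φ`; `momentumSpace = ℝ × (0, ∞)`;
  `phaseDensity Φ μ r w L = Φ(e^{μ r} ε, L)`; `energyDensity`, `radialPressure`,
  `tangentialPressure` = (2.5)–(2.7) as set integrals for a general profile `Φ` and potential `μ`;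
  nonnegativity; the pointwise identity `ε = w²/ε + (L/r²)/ε` and **tracelessness**
  `ρ = p + 2p_T` (`energyDensity_eq_radialPressure_add`, under integrability; for the polytropic
  ansatz integrability is PROVED at every `r > 0`: bounded integrand on the bounded momentum region
  `|w| ≤ E₀e^{-μ}`, `L ≤ r²E₀²e^{-2μ}` — `integrableOn_mul_phaseDensity`); a sufficient barrier
  criterion `E₀ R ≤ e^{μ(R)} √L₀ ⇒ Φ(e^{μ(R)} ε(R,·,·), ·) ≡ 0` (`polytropicAnsatz_energy_eq_zero`).
* `StaticMasslessVlasovShell M₀` — a static spherically symmetric massless Einstein–Vlasov shell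
  around a Schwarzschild black hole of mass `M₀ > 0`: parameters `E₀ L₀ k l`, support radii
  `3M₀ < Rin < Rout`, unknowns `μ m : ℝ → ℝ`, with, for every `r > 2M₀`: `m = M₀` on the vacuum gap
  `(2M₀, Rin]`, no horizon `2m < r`, `m' = 4πr²ρ`, `μ' = (m + 4πr³p)/(r(r - 2m))` where
  `ρ, p` are the CUT-OFF matter quantities `1_{[Rin,Rout]} · (2.5), (2.6)` of the polytropic ansatz,
  the barrier condition at `Rin` and `Rout`, and the paper's time normalisation
  `e^{2μ(Rin)} = 1 - 2M₀/Rin` ("data given at `r = R₀`", Theorem 3.10).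
  API: `S.ρ`, `S.p`, `S.pT`, `S.admMass = m(Rout)`, `S.massFraction = η` with
  `admMass = M₀(1 + η)`; `ρ = p + 2 p_T` everywhere on `r > 0` (`ρ_eq_p_add_two_mul_pT`); `ρ, p, p_T ≥ 0`;
  the densities vanish at `Rin`, `Rout` and off `[Rin, Rout]`; `m` is monotone on `(2M₀, ∞)`, equals
  `admMass` on `[Rout, ∞)`, `M₀ ≤ admMass`, `2·admMass < Rout`; the gap is exactly Schwarzschild of
  mass `M₀`: `e^{2μ(r)} = 1 - 2M₀/r` on `(2M₀, Rin]` (`exp_two_mul_μ_of_le_Rin`); the exterior is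
  exactly Schwarzschild of mass `admMass` up to the constant redshift `μ∞ := lim μ`
  (`S.μInfty`, `tendsto_μ`): `e^{2(μ(r) - μ∞)} = 1 - 2·admMass/r` for `r ≥ Rout`
  (`exp_two_mul_μ_sub_μInfty`), so `μ - μ∞` is the asymptotically flat potential of Remark 3.6.
* `Andreasson2021_shellExistence` — Theorems 3.5/3.10 as a NAMED FACT (not proved here).

## Design choices / what is NOT here

* Real-ODE presentation matching `CapacityLaw` (`m ν ρ p q : ℝ → ℝ`, `HasDerivAt` at every
  `r > 2M_BH`): a shell `S` feeds that item with `ν := S.μ` (or `S.μ - S.μInfty`), `ρ := S.ρ`,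
  `p := S.p`, `q := S.pT`. Values of `μ, m` on `r ≤ 2M₀` are irrelevant junk. `λ` is not a separate
  unknown (`e^{-2λ} := 1 - 2m/r`).
* **Time normalisation = the paper's** (§3: "In a vacuum region in the exterior of the black hole it
  holds that `e^{2μ(r)} = 1 - 2M₀/r`"; data `e^{2μ(R₀)} = e^{-2λ(R₀)} = 1 - 2M₀/R₀`), NOT `μ(∞) = 0`:
  the static Killing time is only defined up to a constant factor, `μ ↦ μ + c` rescales the conserved
  energy `E ↦ e^{c} E`, and for `k > 0` this multiplies the ansatz (2.9) by the constant `e^{-ck}`;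
  so "ansatz (2.9) with amplitude one" is a normalisation-dependent statement and we keep the one in
  which the theorems are proved. `μ` then has a finite limit `μ∞` (proved, `tendsto_μ`) and the
  asymptotically flat potential is `μ - μ∞` (Remark 3.6: "we rescale by letting `Ẽ₀ := e^{μ(∞)}` and
  `μ̃(r) := μ(r) - μ(∞)`").
* Matter integrals are Bochner set integrals over `momentumSpace` w.r.t. Lebesgue measure on `ℝ × ℝ`
  (junk `0` if not integrable — which provably does not happen for the polytropic ansatz at `r > 0`).
* One ansatz, one slab: several nested shells (Remark 3.9) are several such objects glued along
  Schwarzschild gaps and are not a single `StaticMasslessVlasovShell`.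
* The trivial member (no matter at all: the ansatz vanishing on the whole slab, `m ≡ M₀`,
  `e^{2μ} = 1 - 2M₀/r`) is not excluded; `Andreasson2021_shellExistence` asks for `M₀ < admMass`.
* NOT here: the generalized Tolman–Oppenheimer–Volkov identity
  `p' = -μ'(ρ + p) - 2(p - p_T)/r` satisfied by ansatz solutions (differentiation under the integral
  sign; used in §4 via "the fundamental equation (10) in [A0]"), the explicit `k = 0, l = 1/2`
  formulas of §3 for `ρ, p` (Lemma 3.3), the Buchdahl-type bound `Γ < 8/9`, and the existence proof.
-/

noncomputable section

open MeasureTheory Set Filter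
open scoped Topology Real

namespace Literature.Geometry.Lorentzian

namespace MasslessVlasov

/-! ### Momentum-space quantities of massless particles -/

/-- The particle energy variable `ε(r, w, L) = √(w² + L/r²)` of a massless particle at area radius
`r` with radial momentum `w` and squared angular momentum `L` (so that `E = e^{μ} ε` is conserved
along geodesics of the static metric). [cite: Andreasson2021, §2, after (2.4)] -/
def energy (r w L : ℝ) : ℝ := Real.sqrt (w ^ 2 + L / r ^ 2)

/-- `ε ≥ 0`. [folklore] -/
theorem energy_nonneg (r w L : ℝ) : 0 ≤ energy r w L := Real.sqrt_nonneg _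

/-- `ε² = w² + L/r²` for `L ≥ 0`. [folklore] -/
theorem energy_sq {r w L : ℝ} (hL : 0 ≤ L) : energy r w L ^ 2 = w ^ 2 + L / r ^ 2 :=
  Real.sq_sqrt (by positivity)

/-- `|w| ≤ ε` for `L ≥ 0`. [folklore] -/
theorem abs_le_energy {r w L : ℝ} (hL : 0 ≤ L) : |w| ≤ energy r w L := by
  rw [← Real.sqrt_sq_eq_abs]
  exact Real.sqrt_le_sqrt (by have := div_nonneg hL (sq_nonneg r); linarith)

/-- `L/r² ≤ ε²` for `L ≥ 0`. [folklore] -/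
theorem div_sq_le_energy_sq {r w L : ℝ} (hL : 0 ≤ L) : L / r ^ 2 ≤ energy r w L ^ 2 := by
  rw [energy_sq hL]; nlinarith [sq_nonneg w]

/-- `√L / r ≤ ε` for `L ≥ 0`, `r > 0` (the centrifugal barrier). [folklore] -/
theorem sqrt_div_le_energy {r w L : ℝ} (hr : 0 < r) (hL : 0 ≤ L) :
    Real.sqrt L / r ≤ energy r w L := by
  have h1 : Real.sqrt L / r = Real.sqrt (L / r ^ 2) := by
    rw [Real.sqrt_div hL, Real.sqrt_sq hr.le]
  rw [h1]
  exact Real.sqrt_le_sqrt (by nlinarith [sq_nonneg w])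

/-- If `a ≤ ε²` then `a/ε ≤ ε` (also when `ε = 0`, by `a/0 = 0`). [folklore] -/
theorem div_energy_le {r w L a : ℝ} (ha : a ≤ energy r w L ^ 2) :
    a / energy r w L ≤ energy r w L := by
  rcases (energy_nonneg r w L).eq_or_lt with h | h
  · rw [← h]; simp
  · rw [div_le_iff₀ h, ← sq]; exact ha

/-- **Pointwise tracelessness of massless kinetic matter**: `ε = w²/ε + (L/r²)/ε` for all real
`r, w, L` (both sides vanish when `w² + L/r² ≤ 0`). Integrated against `f dL dw` with the weights of
(2.5)–(2.7) this is `ρ = p + 2p_T`. [folklore] -/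
theorem energy_eq_sq_div_add_div (r w L : ℝ) :
    energy r w L = w ^ 2 / energy r w L + L / r ^ 2 / energy r w L := by
  rw [← add_div]
  unfold energy
  rcases le_or_gt (w ^ 2 + L / r ^ 2) 0 with h | h
  · rw [Real.sqrt_eq_zero'.mpr h]; simp
  · rw [eq_div_iff (Real.sqrt_pos.mpr h).ne', Real.mul_self_sqrt h.le]

/-- Measurability of `(w, L) ↦ ε(r, w, L)`. [folklore] -/
theorem measurable_energy (r : ℝ) : Measurable fun z : ℝ × ℝ ↦ energy r z.1 z.2 :=
  Real.continuous_sqrt.measurable.comp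
    ((measurable_fst.pow_const 2).add (measurable_snd.div_const _))

/-! ### The cut-off power and the polytropic ansatz -/

/-- The cut-off power `x₊^a`: `x^a` for `x > 0` and `0` for `x ≤ 0` (real exponent `a`; for `a = 0`
this is the indicator of `x > 0`, the convention under which "the ansatz (2.9) implies that `f = 0`
whenever `E > E₀`" also for `k = 0`). [cite: Andreasson2021, §2, (2.9) (`x₊ := max{x, 0}`)] -/
def cutPow (a x : ℝ) : ℝ := if 0 < x then x ^ a else 0

/-- `x₊^a = x^a` for `x > 0`. [folklore] -/
theorem cutPow_of_pos {a x : ℝ} (h : 0 < x) : cutPow a x = x ^ a := if_pos h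

/-- `x₊^a = 0` for `x ≤ 0`. [folklore] -/
theorem cutPow_of_nonpos {a x : ℝ} (h : x ≤ 0) : cutPow a x = 0 := if_neg (not_lt.mpr h)

/-- `x₊^a ≥ 0`. [folklore] -/
theorem cutPow_nonneg (a x : ℝ) : 0 ≤ cutPow a x := by
  unfold cutPow
  split_ifs with h
  exacts [Real.rpow_nonneg h.le a, le_rfl]

/-- `x₊^a > 0` for `x > 0`. [folklore] -/
theorem cutPow_pos {a x : ℝ} (h : 0 < x) : 0 < cutPow a x := by
  rw [cutPow_of_pos h]; exact Real.rpow_pos_of_pos h a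

/-- `x₊^a ≠ 0` forces `x > 0`. [folklore] -/
theorem pos_of_cutPow_ne_zero {a x : ℝ} (h : cutPow a x ≠ 0) : 0 < x := by
  by_contra hx
  exact h (cutPow_of_nonpos (not_lt.mp hx))

/-- Monotone bound: `x ≤ C`, `0 ≤ C`, `0 ≤ a` give `x₊^a ≤ C^a`. [folklore] -/
theorem cutPow_le_rpow {a x C : ℝ} (ha : 0 ≤ a) (hC : 0 ≤ C) (hxC : x ≤ C) :
    cutPow a x ≤ C ^ a := by
  unfold cutPow
  split_ifs with h
  exacts [Real.rpow_le_rpow h.le hxC ha, Real.rpow_nonneg hC a]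

/-- `cutPow a` is Borel measurable. [folklore] -/
theorem measurable_cutPow (a : ℝ) : Measurable (cutPow a) :=
  Measurable.ite measurableSet_Ioi (measurable_id.pow_const a) measurable_const

/-- The **polytropic ansatz** for massless Vlasov matter,
`Φ(E, L) = (E₀ - E)₊^k (L - L₀)₊^l` (`E` the conserved particle energy `e^{μ} ε`, `L` the squared
angular momentum; the paper takes `l ≥ 1/2`, `k ≥ 0`, `L₀ > 0`, `E₀ > 0`).
[cite: Andreasson2021, §2, (2.9)] -/
def polytropicAnsatz (E₀ L₀ k l : ℝ) (E L : ℝ) : ℝ := cutPow k (E₀ - E) * cutPow l (L - L₀)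

section Ansatz

variable {E₀ L₀ k l E L : ℝ}

/-- `Φ ≥ 0`. [folklore] -/
theorem polytropicAnsatz_nonneg (E₀ L₀ k l E L : ℝ) : 0 ≤ polytropicAnsatz E₀ L₀ k l E L :=
  mul_nonneg (cutPow_nonneg _ _) (cutPow_nonneg _ _)

/-- `Φ(E, L) = 0` for `E ≥ E₀` (energy cut-off). [cite: Andreasson2021, §3 ("f = 0 whenever E > E₀")] -/
theorem polytropicAnsatz_eq_zero_of_le (h : E₀ ≤ E) : polytropicAnsatz E₀ L₀ k l E L = 0 := by
  simp [polytropicAnsatz, cutPow_of_nonpos (sub_nonpos.mpr h)]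

/-- `Φ(E, L) = 0` for `L ≤ L₀` (angular-momentum cut-off). [folklore] -/
theorem polytropicAnsatz_eq_zero_of_le_L₀ (h : L ≤ L₀) : polytropicAnsatz E₀ L₀ k l E L = 0 := by
  simp [polytropicAnsatz, cutPow_of_nonpos (sub_nonpos.mpr h)]

/-- Where `Φ ≠ 0` one has `E < E₀` and `L₀ < L`. [folklore] -/
theorem lt_of_polytropicAnsatz_ne_zero (h : polytropicAnsatz E₀ L₀ k l E L ≠ 0) :
    E < E₀ ∧ L₀ < L := by
  constructor
  · by_contra h'
    exact h (polytropicAnsatz_eq_zero_of_le (not_lt.mp h'))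
  · by_contra h'
    exact h (polytropicAnsatz_eq_zero_of_le_L₀ (not_lt.mp h'))

/-- Uniform bound `Φ(E, L) ≤ E₀^k C^l` for `0 ≤ E`, `L ≤ C` (`E₀, L₀, C, k, l ≥ 0`). [folklore] -/
theorem polytropicAnsatz_le (hE₀ : 0 ≤ E₀) (hL₀ : 0 ≤ L₀) (hk : 0 ≤ k) (hl : 0 ≤ l) (hE : 0 ≤ E)
    {C : ℝ} (hC : 0 ≤ C) (hLC : L ≤ C) :
    polytropicAnsatz E₀ L₀ k l E L ≤ E₀ ^ k * C ^ l :=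
  mul_le_mul (cutPow_le_rpow hk hE₀ (by linarith)) (cutPow_le_rpow hl hC (by linarith))
    (cutPow_nonneg _ _) (Real.rpow_nonneg hE₀ k)

/-- **Barrier criterion.** If `E₀ R ≤ c √L₀` (`c ≥ 0`, `R > 0`), then
`Φ(c · ε(R, w, L), L) = 0` for all `w` and all `L > 0`: at radius `R` every particle with `L > L₀`
has `c ε ≥ c √L / R ≥ c √L₀ / R ≥ E₀`, so no particle of the ensemble is present at `r = R`. With
`c = e^{μ(R)}` this is the condition `γ(R) ≤ 0` of the paper (`γ := -μ - ½ log (L₀/r²)`, `E₀ = 1`;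
`γ(R₀) = 0 = γ(R₁)` for the shells constructed there).
[cite: Andreasson2021, §3 (definition of R₀) and §4 (γ)] -/
theorem polytropicAnsatz_energy_eq_zero {c R : ℝ} (hc : 0 ≤ c) (hR : 0 < R)
    (h : E₀ * R ≤ c * Real.sqrt L₀) (w : ℝ) {L : ℝ} (hL : 0 < L) :
    polytropicAnsatz E₀ L₀ k l (c * energy R w L) L = 0 := by
  rcases le_or_gt L L₀ with hLL | hLL
  · exact polytropicAnsatz_eq_zero_of_le_L₀ hLL
  · refine polytropicAnsatz_eq_zero_of_le ?_
    have h1 : Real.sqrt L₀ / R ≤ energy R w L :=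
      (div_le_div_of_nonneg_right (Real.sqrt_le_sqrt hLL.le) hR.le).trans
        (sqrt_div_le_energy hR hL.le)
    have h2 : E₀ ≤ c * (Real.sqrt L₀ / R) := by
      rw [mul_div_assoc', le_div_iff₀ hR]; exact h
    exact h2.trans (mul_le_mul_of_nonneg_left h1 hc)

end Ansatz

/-! ### Matter quantities (2.5)–(2.7) for a profile `Φ(E, L)` and a potential `μ` -/

/-- Momentum space of the reduced variables: `(w, L) ∈ ℝ × (0, ∞)`. [cite: Andreasson2021, §2, (2.5)–(2.7)] -/
def momentumSpace : Set (ℝ × ℝ) := univ ×ˢ Ioi 0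

/-- `momentumSpace` is measurable. [folklore] -/
theorem measurableSet_momentumSpace : MeasurableSet momentumSpace :=
  MeasurableSet.univ.prod measurableSet_Ioi

/-- The phase-space density of an ansatz solution: `f(r, w, L) = Φ(E, L)` with `E = e^{μ(r)} ε(r,w,L)`
(solves the static Vlasov equation (2.4)). [cite: Andreasson2021, §2, (2.8)] -/
def phaseDensity (Φ : ℝ → ℝ → ℝ) (μ : ℝ → ℝ) (r w L : ℝ) : ℝ :=
  Φ (Real.exp (μ r) * energy r w L) L

/-- Energy density `ρ(r) = π/r² ∫∫ ε f dL dw`. [cite: Andreasson2021, §2, (2.5)] -/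
def energyDensity (Φ : ℝ → ℝ → ℝ) (μ : ℝ → ℝ) (r : ℝ) : ℝ :=
  π / r ^ 2 * ∫ z in momentumSpace, energy r z.1 z.2 * phaseDensity Φ μ r z.1 z.2

/-- Radial pressure `p(r) = π/r² ∫∫ (w²/ε) f dL dw`. [cite: Andreasson2021, §2, (2.6)] -/
def radialPressure (Φ : ℝ → ℝ → ℝ) (μ : ℝ → ℝ) (r : ℝ) : ℝ :=
  π / r ^ 2 * ∫ z in momentumSpace, z.1 ^ 2 / energy r z.1 z.2 * phaseDensity Φ μ r z.1 z.2

/-- Tangential pressure `p_T(r) = π/(2r⁴) ∫∫ (L/ε) f dL dw`. [cite: Andreasson2021, §2, (2.7)] -/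
def tangentialPressure (Φ : ℝ → ℝ → ℝ) (μ : ℝ → ℝ) (r : ℝ) : ℝ :=
  π / (2 * r ^ 4) * ∫ z in momentumSpace, z.2 / energy r z.1 z.2 * phaseDensity Φ μ r z.1 z.2

section Matter

variable {Φ : ℝ → ℝ → ℝ} {μ : ℝ → ℝ} {r : ℝ}

/-- `ρ ≥ 0` for `Φ ≥ 0`. [folklore] -/
theorem energyDensity_nonneg (hΦ : ∀ E L, 0 ≤ Φ E L) (μ : ℝ → ℝ) (r : ℝ) :
    0 ≤ energyDensity Φ μ r :=
  mul_nonneg (div_nonneg Real.pi_pos.le (sq_nonneg r))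
    (setIntegral_nonneg measurableSet_momentumSpace fun _ _ ↦
      mul_nonneg (energy_nonneg _ _ _) (hΦ _ _))

/-- `p ≥ 0` for `Φ ≥ 0`. [folklore] -/
theorem radialPressure_nonneg (hΦ : ∀ E L, 0 ≤ Φ E L) (μ : ℝ → ℝ) (r : ℝ) :
    0 ≤ radialPressure Φ μ r :=
  mul_nonneg (div_nonneg Real.pi_pos.le (sq_nonneg r))
    (setIntegral_nonneg measurableSet_momentumSpace fun _ _ ↦
      mul_nonneg (div_nonneg (sq_nonneg _) (energy_nonneg _ _ _)) (hΦ _ _))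

/-- `p_T ≥ 0` for `Φ ≥ 0`. [folklore] -/
theorem tangentialPressure_nonneg (hΦ : ∀ E L, 0 ≤ Φ E L) (μ : ℝ → ℝ) (r : ℝ) :
    0 ≤ tangentialPressure Φ μ r :=
  mul_nonneg (div_nonneg Real.pi_pos.le (by positivity))
    (setIntegral_nonneg measurableSet_momentumSpace fun z hz ↦
      mul_nonneg (div_nonneg (le_of_lt hz.2) (energy_nonneg _ _ _)) (hΦ _ _))

/-- If the profile vanishes identically at radius `r` (barrier), then `ρ(r) = 0`. [folklore] -/
theorem energyDensity_eq_zero_of_forall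
    (h : ∀ w L, 0 < L → Φ (Real.exp (μ r) * energy r w L) L = 0) : energyDensity Φ μ r = 0 := by
  unfold energyDensity
  rw [setIntegral_eq_zero_of_forall_eq_zero fun z hz ↦ by simp [phaseDensity, h z.1 z.2 hz.2],
    mul_zero]

/-- If the profile vanishes identically at radius `r` (barrier), then `p(r) = 0`. [folklore] -/
theorem radialPressure_eq_zero_of_forall
    (h : ∀ w L, 0 < L → Φ (Real.exp (μ r) * energy r w L) L = 0) : radialPressure Φ μ r = 0 := by
  unfold radialPressure
  rw [setIntegral_eq_zero_of_forall_eq_zero fun z hz ↦ by simp [phaseDensity, h z.1 z.2 hz.2],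
    mul_zero]

/-- If the profile vanishes identically at radius `r` (barrier), then `p_T(r) = 0`. [folklore] -/
theorem tangentialPressure_eq_zero_of_forall
    (h : ∀ w L, 0 < L → Φ (Real.exp (μ r) * energy r w L) L = 0) :
    tangentialPressure Φ μ r = 0 := by
  unfold tangentialPressure
  rw [setIntegral_eq_zero_of_forall_eq_zero fun z hz ↦ by simp [phaseDensity, h z.1 z.2 hz.2],
    mul_zero]

/-- **Tracelessness `ρ = p + 2 p_T`** of massless kinetic matter (any profile `Φ`, any `μ`, any `r`),
provided the `p`- and `p_T`-integrands are integrable (then so is the `ρ`-integrand, their sum).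
[cite: Andreasson2021, §4 ("in the present massless case we have p + 2p_T = ρ")] -/
theorem energyDensity_eq_radialPressure_add
    (hp : IntegrableOn (fun z : ℝ × ℝ ↦ z.1 ^ 2 / energy r z.1 z.2 * phaseDensity Φ μ r z.1 z.2)
      momentumSpace)
    (hq : IntegrableOn (fun z : ℝ × ℝ ↦ z.2 / energy r z.1 z.2 * phaseDensity Φ μ r z.1 z.2)
      momentumSpace) :
    energyDensity Φ μ r = radialPressure Φ μ r + 2 * tangentialPressure Φ μ r := by
  have hq' : IntegrableOn (fun z : ℝ × ℝ ↦
      z.2 / r ^ 2 / energy r z.1 z.2 * phaseDensity Φ μ r z.1 z.2) momentumSpace := by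
    refine IntegrableOn.congr_fun (hq.const_mul (r ^ 2)⁻¹) (fun z _ ↦ ?_)
      measurableSet_momentumSpace
    ring
  have h1 : (fun z : ℝ × ℝ ↦ energy r z.1 z.2 * phaseDensity Φ μ r z.1 z.2) = fun z ↦
      z.1 ^ 2 / energy r z.1 z.2 * phaseDensity Φ μ r z.1 z.2 +
        z.2 / r ^ 2 / energy r z.1 z.2 * phaseDensity Φ μ r z.1 z.2 := by
    funext z; rw [← add_mul, ← energy_eq_sq_div_add_div]
  have h2 : (fun z : ℝ × ℝ ↦ z.2 / r ^ 2 / energy r z.1 z.2 * phaseDensity Φ μ r z.1 z.2) =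
      fun z ↦ (r ^ 2)⁻¹ * (z.2 / energy r z.1 z.2 * phaseDensity Φ μ r z.1 z.2) := by
    funext z; ring
  unfold energyDensity radialPressure tangentialPressure
  rw [h1, integral_add hp hq', mul_add, h2, integral_const_mul]
  ring

end Matter

/-! ### Integrability of the polytropic matter integrands -/

section Integrable

variable {E₀ L₀ k l : ℝ}

/-- **Master integrability lemma.** For the polytropic ansatz with `E₀, L₀ > 0`, `k, l ≥ 0`, at any
radius `r > 0` and for any potential `μ`, a measurable weight `g` with `|g| ≤ K ε` on momentum
space gives an integrable `g · f`: where `f ≠ 0` one has `e^{μ(r)} ε < E₀` and `L₀ < L ≤ r² ε²`,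
so the integrand is bounded (by `K E₀e^{-μ} · E₀^k (r²E₀²e^{-2μ})^l`) and supported in the
bounded box `|w| ≤ E₀e^{-μ}`, `0 ≤ L ≤ r²E₀²e^{-2μ}`. [folklore] -/
theorem integrableOn_mul_phaseDensity (hE₀ : 0 < E₀) (hL₀ : 0 < L₀) (hk : 0 ≤ k) (hl : 0 ≤ l)
    (μ : ℝ → ℝ) {r : ℝ} (hr : 0 < r) {g : ℝ × ℝ → ℝ} (hg : Measurable g) {K : ℝ} (hK : 0 ≤ K)
    (hgb : ∀ z ∈ momentumSpace, |g z| ≤ K * energy r z.1 z.2) :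
    IntegrableOn (fun z : ℝ × ℝ ↦ g z * phaseDensity (polytropicAnsatz E₀ L₀ k l) μ r z.1 z.2)
      momentumSpace := by
  have hc : 0 < Real.exp (μ r) := Real.exp_pos _
  set Em : ℝ := E₀ / Real.exp (μ r) with hEm_def
  have hEm : 0 < Em := div_pos hE₀ hc
  set B : Set (ℝ × ℝ) := Icc (-Em) Em ×ˢ Icc 0 (r ^ 2 * Em ^ 2) with hB_def
  -- (1) where the integrand is nonzero
  have key : ∀ z : ℝ × ℝ, z ∈ momentumSpace →
      g z * phaseDensity (polytropicAnsatz E₀ L₀ k l) μ r z.1 z.2 ≠ 0 →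
      energy r z.1 z.2 < Em ∧ z ∈ B ∧ z.2 ≤ r ^ 2 * Em ^ 2 := by
    intro z hzS hz
    have hL : 0 < z.2 := hzS.2
    have hΦ : polytropicAnsatz E₀ L₀ k l (Real.exp (μ r) * energy r z.1 z.2) z.2 ≠ 0 :=
      right_ne_zero_of_mul hz
    obtain ⟨hE, -⟩ := lt_of_polytropicAnsatz_ne_zero hΦ
    have hε : energy r z.1 z.2 < Em := by
      rw [hEm_def, lt_div_iff₀ hc, mul_comm]; exact hE
    have hεnn := energy_nonneg r z.1 z.2
    have hL2 : z.2 ≤ r ^ 2 * Em ^ 2 := by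
      have h1 : z.2 / r ^ 2 ≤ energy r z.1 z.2 ^ 2 := div_sq_le_energy_sq hL.le
      have h2 : energy r z.1 z.2 ^ 2 ≤ Em ^ 2 := pow_le_pow_left₀ hεnn hε.le 2
      rw [div_le_iff₀ (by positivity)] at h1
      nlinarith
    have hw : |z.1| ≤ energy r z.1 z.2 := abs_le_energy hL.le
    refine ⟨hε, ⟨⟨?_, ?_⟩, hL.le, hL2⟩, hL2⟩
    · linarith [neg_abs_le z.1]
    · linarith [le_abs_self z.1]
  -- (2) a uniform bound
  have bound : ∀ z : ℝ × ℝ, ‖g z * phaseDensity (polytropicAnsatz E₀ L₀ k l) μ r z.1 z.2‖ ≤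
      K * Em * (E₀ ^ k * (r ^ 2 * Em ^ 2) ^ l) := by
    intro z
    have hM : 0 ≤ K * Em * (E₀ ^ k * (r ^ 2 * Em ^ 2) ^ l) := by positivity
    by_cases hz : g z * phaseDensity (polytropicAnsatz E₀ L₀ k l) μ r z.1 z.2 = 0
    · rw [hz, norm_zero]; exact hM
    by_cases hzS : z ∈ momentumSpace
    · obtain ⟨hε, -, hL2⟩ := key z hzS hz
      have hΦnn : 0 ≤ phaseDensity (polytropicAnsatz E₀ L₀ k l) μ r z.1 z.2 :=
        polytropicAnsatz_nonneg _ _ _ _ _ _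
      rw [Real.norm_eq_abs, abs_mul, abs_of_nonneg hΦnn]
      refine mul_le_mul ((hgb z hzS).trans (mul_le_mul_of_nonneg_left hε.le hK)) ?_
        hΦnn (mul_nonneg hK hEm.le)
      exact polytropicAnsatz_le hE₀.le hL₀.le hk hl (mul_nonneg hc.le (energy_nonneg _ _ _))
        (by positivity) hL2
    · exfalso
      apply hz
      have hL : z.2 ≤ 0 := by simpa [momentumSpace] using hzS
      simp [phaseDensity, polytropicAnsatz_eq_zero_of_le_L₀ (hL.trans hL₀.le)]
  -- (3) measurability
  have hFm : Measurable fun z : ℝ × ℝ ↦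
      g z * phaseDensity (polytropicAnsatz E₀ L₀ k l) μ r z.1 z.2 :=
    hg.mul (((measurable_cutPow k).comp (measurable_const.sub
      (measurable_const.mul (measurable_energy r)))).mul
        ((measurable_cutPow l).comp (measurable_snd.sub measurable_const)))
  -- (4) integrable on the box, and zero on `momentumSpace \ B`
  have hB : IntegrableOn
      (fun z : ℝ × ℝ ↦ g z * phaseDensity (polytropicAnsatz E₀ L₀ k l) μ r z.1 z.2) B volume := by
    refine Measure.integrableOn_of_bounded ?_ hFm.aestronglyMeasurable (Eventually.of_forall bound)
    rw [hB_def, Measure.volume_eq_prod, Measure.prod_prod]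
    exact ENNReal.mul_ne_top (by simp [Real.volume_Icc]) (by simp [Real.volume_Icc])
  refine hB.of_forall_sdiff_eq_zero measurableSet_momentumSpace fun z hz ↦ ?_
  by_contra h
  exact hz.2 (key z hz.1 h).2.1

/-- The `ρ`-integrand `ε f` of the polytropic ansatz is integrable at every `r > 0`. [folklore] -/
theorem integrableOn_energy_mul_phaseDensity (hE₀ : 0 < E₀) (hL₀ : 0 < L₀) (hk : 0 ≤ k)
    (hl : 0 ≤ l) (μ : ℝ → ℝ) {r : ℝ} (hr : 0 < r) :
    IntegrableOn (fun z : ℝ × ℝ ↦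
      energy r z.1 z.2 * phaseDensity (polytropicAnsatz E₀ L₀ k l) μ r z.1 z.2) momentumSpace :=
  integrableOn_mul_phaseDensity hE₀ hL₀ hk hl μ hr (measurable_energy r) zero_le_one
    fun z _ ↦ by rw [one_mul, abs_of_nonneg (energy_nonneg _ _ _)]

/-- The `p`-integrand `(w²/ε) f` of the polytropic ansatz is integrable at every `r > 0`. [folklore] -/
theorem integrableOn_sq_div_mul_phaseDensity (hE₀ : 0 < E₀) (hL₀ : 0 < L₀) (hk : 0 ≤ k)
    (hl : 0 ≤ l) (μ : ℝ → ℝ) {r : ℝ} (hr : 0 < r) :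
    IntegrableOn (fun z : ℝ × ℝ ↦
      z.1 ^ 2 / energy r z.1 z.2 * phaseDensity (polytropicAnsatz E₀ L₀ k l) μ r z.1 z.2)
      momentumSpace := by
  refine integrableOn_mul_phaseDensity hE₀ hL₀ hk hl μ hr
    ((measurable_fst.pow_const 2).div (measurable_energy r)) zero_le_one fun z hz ↦ ?_
  rw [one_mul, abs_of_nonneg (div_nonneg (sq_nonneg _) (energy_nonneg _ _ _))]
  refine div_energy_le ?_
  rw [energy_sq (le_of_lt hz.2)]
  linarith [div_nonneg (le_of_lt hz.2) (sq_nonneg r)]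

/-- The `p_T`-integrand `(L/ε) f` of the polytropic ansatz is integrable at every `r > 0`. [folklore] -/
theorem integrableOn_div_mul_phaseDensity (hE₀ : 0 < E₀) (hL₀ : 0 < L₀) (hk : 0 ≤ k)
    (hl : 0 ≤ l) (μ : ℝ → ℝ) {r : ℝ} (hr : 0 < r) :
    IntegrableOn (fun z : ℝ × ℝ ↦
      z.2 / energy r z.1 z.2 * phaseDensity (polytropicAnsatz E₀ L₀ k l) μ r z.1 z.2)
      momentumSpace := by
  refine integrableOn_mul_phaseDensity hE₀ hL₀ hk hl μ hr
    (measurable_snd.div (measurable_energy r)) (sq_nonneg r) fun z hz ↦ ?_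
  have hL : 0 ≤ z.2 := le_of_lt hz.2
  rw [abs_of_nonneg (div_nonneg hL (energy_nonneg _ _ _))]
  have h1 : z.2 / energy r z.1 z.2 = r ^ 2 * (z.2 / r ^ 2 / energy r z.1 z.2) := by
    field_simp
  rw [h1]
  exact mul_le_mul_of_nonneg_left (div_energy_le (div_sq_le_energy_sq hL)) (sq_nonneg r)

end Integrable

end MasslessVlasov

open MasslessVlasov

/-! ### The shell -/

/-- A **static, spherically symmetric shell of massless Vlasov matter surrounding a Schwarzschild
black hole of mass `M₀ > 0`** (Andréasson 2021, §2–§3), in Schwarzschild coordinates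
`ds² = -e^{2μ} dt² + e^{2λ} dr² + r² dΩ²`, `e^{-2λ} = 1 - 2m/r`, on the black-hole exterior
`r > 2M₀`. Data: the polytropic parameters `E₀, L₀ > 0`, `k ≥ 0`, `l ≥ 1/2` of the ansatz
`f = Φ(e^{μ} ε, L)`, `Φ(E, L) = (E₀ - E)₊^k (L - L₀)₊^l` [(2.8)–(2.9)]; the matter slab
`[Rin, Rout]` with `3M₀ < Rin < Rout` (the matter sits outside the photon sphere of the hole and
`f` is CUT OFF to the slab, as in §3: `f = 0` on `[2M₀, R₀]` and Schwarzschild glued at `R₁`); the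
metric exponent `μ` and the Hawking mass `m`. Axioms, for every `r > 2M₀`: `m = M₀` on the vacuum
gap `(2M₀, Rin]`; no horizon `2m(r) < r`; the reduced Einstein equations (2.1)–(2.2) in the form
`m' = 4πr²ρ`, `μ' = (m + 4πr³p)/(r(r - 2m))` with `ρ, p` the cut-off matter quantities
`1_{[Rin,Rout]}(r) · (2.5), (2.6)`; the barrier condition (the ansatz vanishes identically at
`r = Rin` and at `r = Rout`, which makes the cut-off `f` a solution of the static Vlasov equation
(2.4) — `E`, `L` are conserved and no particle of the ensemble reaches the two radii); and the time
normalisation of the paper, `e^{2μ(Rin)} = 1 - 2M₀/Rin` (Schwarzschild in standard form on the gap;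
`μ` then converges at infinity and `μ - lim μ` is the asymptotically flat potential, Remark 3.6;
`λ → 0` is automatic). The ADM mass is `admMass = m(Rout)` and `admMass = M₀ (1 + massFraction)`.
Existence of non-trivial such shells is Andréasson's theorem (`Andreasson2021_shellExistence`), not
part of the definition.
[cite: Andreasson2021, §2 (2.1)–(2.10) and §3 (set-up, data at R₀), Theorems 3.5 and 3.10] -/
structure StaticMasslessVlasovShell (M₀ : ℝ) where
  /-- energy cut-off `E₀ > 0` of the ansatz -/
  E₀ : ℝ
  /-- angular-momentum cut-off `L₀ > 0` of the ansatz -/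
  L₀ : ℝ
  /-- polytropic exponent `k ≥ 0` -/
  k : ℝ
  /-- polytropic exponent `l ≥ 1/2` -/
  l : ℝ
  /-- inner radius of the matter slab (`R₀` in the paper) -/
  Rin : ℝ
  /-- outer radius of the matter slab (`R₁` in the paper) -/
  Rout : ℝ
  /-- the metric exponent `μ` (`g_tt = -e^{2μ}`) -/
  μ : ℝ → ℝ
  /-- the Hawking mass `m` (`e^{-2λ} = 1 - 2m/r`) -/
  m : ℝ → ℝ
  M₀_pos : 0 < M₀
  E₀_pos : 0 < E₀
  L₀_pos : 0 < L₀
  k_nonneg : 0 ≤ k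
  half_le_l : 1 / 2 ≤ l
  /-- the matter lies outside the photon sphere `r = 3M₀` of the black hole -/
  three_mul_lt_Rin : 3 * M₀ < Rin
  Rin_lt_Rout : Rin < Rout
  /-- vacuum gap: `m = M₀` on `(2M₀, Rin]` (Schwarzschild of mass `M₀` inside the shell) -/
  m_eq_of_le_Rin : ∀ r, 2 * M₀ < r → r ≤ Rin → m r = M₀
  /-- no horizon outside the black hole: `2m/r < 1` -/
  two_mul_m_lt : ∀ r, 2 * M₀ < r → 2 * m r < r
  /-- (2.1): `m' = 4π r² ρ` with the cut-off energy density -/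
  hasDerivAt_m : ∀ r, 2 * M₀ < r → HasDerivAt m
    (4 * π * r ^ 2 * (Icc Rin Rout).indicator (energyDensity (polytropicAnsatz E₀ L₀ k l) μ) r) r
  /-- (2.2): `μ' = (m + 4π r³ p) / (r (r - 2m))` with the cut-off radial pressure -/
  hasDerivAt_μ : ∀ r, 2 * M₀ < r → HasDerivAt μ
    ((m r + 4 * π * r ^ 3 *
        (Icc Rin Rout).indicator (radialPressure (polytropicAnsatz E₀ L₀ k l) μ) r) /
      (r * (r - 2 * m r))) r
  /-- barrier at the inner radius: no particle of the ensemble at `r = Rin` -/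
  ansatz_Rin : ∀ w L, 0 < L →
    polytropicAnsatz E₀ L₀ k l (Real.exp (μ Rin) * energy Rin w L) L = 0
  /-- barrier at the outer radius: no particle of the ensemble at `r = Rout` -/
  ansatz_Rout : ∀ w L, 0 < L →
    polytropicAnsatz E₀ L₀ k l (Real.exp (μ Rout) * energy Rout w L) L = 0
  /-- time normalisation: Schwarzschild data at the inner edge, `e^{2μ(Rin)} = 1 - 2M₀/Rin` -/
  exp_two_mul_μ_Rin : Real.exp (2 * μ Rin) = 1 - 2 * M₀ / Rin

namespace StaticMasslessVlasovShell

variable {M₀ : ℝ} (S : StaticMasslessVlasovShell M₀)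

/-- The profile `Φ = (E₀ - E)₊^k (L - L₀)₊^l` of the shell. [cite: Andreasson2021, §2, (2.9)] -/
def Φ : ℝ → ℝ → ℝ := polytropicAnsatz S.E₀ S.L₀ S.k S.l

/-- The phase-space density of the shell, `f(r, w, L) = 1_{[Rin,Rout]}(r) Φ(e^{μ(r)} ε, L)`.
[cite: Andreasson2021, §3 (f = 0 on [2M₀, R₀]; Schwarzschild attached at R₁)] -/
def f (r w L : ℝ) : ℝ := (Icc S.Rin S.Rout).indicator (fun r ↦ phaseDensity S.Φ S.μ r w L) r

/-- The energy density `ρ` of the shell (cut off to the slab). [cite: Andreasson2021, §2, (2.5)] -/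
def ρ : ℝ → ℝ := (Icc S.Rin S.Rout).indicator (energyDensity S.Φ S.μ)

/-- The radial pressure `p` of the shell (cut off to the slab). [cite: Andreasson2021, §2, (2.6)] -/
def p : ℝ → ℝ := (Icc S.Rin S.Rout).indicator (radialPressure S.Φ S.μ)

/-- The tangential pressure `p_T` of the shell (cut off to the slab). [cite: Andreasson2021, §2, (2.7)] -/
def pT : ℝ → ℝ := (Icc S.Rin S.Rout).indicator (tangentialPressure S.Φ S.μ)

/-- The ADM mass `M = m(Rout)` (`= lim_{r → ∞} m(r)`, `tendsto_m`). [cite: Andreasson2021, Theorem 3.5] -/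
def admMass : ℝ := S.m S.Rout

/-- The mass fraction `η` of the shell relative to the hole: `M = M₀ (1 + η)`. [folklore] -/
def massFraction : ℝ := S.admMass / M₀ - 1

/-- The slab lies outside the horizon: `2M₀ < Rin`. [folklore] -/
theorem two_mul_lt_Rin : 2 * M₀ < S.Rin := by linarith [S.three_mul_lt_Rin, S.M₀_pos]

/-- `2M₀ < Rout`. [folklore] -/
theorem two_mul_lt_Rout : 2 * M₀ < S.Rout := S.two_mul_lt_Rin.trans S.Rin_lt_Rout

/-- `0 < Rin`. [folklore] -/
theorem Rin_pos : 0 < S.Rin := by linarith [S.two_mul_lt_Rin, S.M₀_pos]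

/-- `0 < Rout`. [folklore] -/
theorem Rout_pos : 0 < S.Rout := S.Rin_pos.trans S.Rin_lt_Rout

/-- (2.1) restated: `m' = 4π r² ρ` on `r > 2M₀`. [cite: Andreasson2021, §2, (2.1)] -/
theorem hasDerivAt_m' {r : ℝ} (hr : 2 * M₀ < r) : HasDerivAt S.m (4 * π * r ^ 2 * S.ρ r) r :=
  S.hasDerivAt_m r hr

/-- (2.2) restated: `μ' = (m + 4π r³ p)/(r (r - 2m))` on `r > 2M₀`. [cite: Andreasson2021, §2, (2.2)] -/
theorem hasDerivAt_μ' {r : ℝ} (hr : 2 * M₀ < r) :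
    HasDerivAt S.μ ((S.m r + 4 * π * r ^ 3 * S.p r) / (r * (r - 2 * S.m r))) r :=
  S.hasDerivAt_μ r hr

/-- `m` is continuous on `r > 2M₀`. [folklore] -/
theorem continuousAt_m {r : ℝ} (hr : 2 * M₀ < r) : ContinuousAt S.m r :=
  (S.hasDerivAt_m' hr).continuousAt

/-- `Φ ≥ 0`. [folklore] -/
theorem Φ_nonneg (E L : ℝ) : 0 ≤ S.Φ E L := polytropicAnsatz_nonneg _ _ _ _ _ _

/-- `f ≥ 0`. [folklore] -/
theorem f_nonneg (r w L : ℝ) : 0 ≤ S.f r w L :=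
  Set.indicator_nonneg (fun _ _ ↦ S.Φ_nonneg _ _) _

/-- `ρ ≥ 0`. [folklore] -/
theorem ρ_nonneg (r : ℝ) : 0 ≤ S.ρ r :=
  Set.indicator_nonneg (fun r _ ↦ energyDensity_nonneg S.Φ_nonneg S.μ r) _

/-- `p ≥ 0`. [folklore] -/
theorem p_nonneg (r : ℝ) : 0 ≤ S.p r :=
  Set.indicator_nonneg (fun r _ ↦ radialPressure_nonneg S.Φ_nonneg S.μ r) _

/-- `p_T ≥ 0`. [folklore] -/
theorem pT_nonneg (r : ℝ) : 0 ≤ S.pT r :=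
  Set.indicator_nonneg (fun r _ ↦ tangentialPressure_nonneg S.Φ_nonneg S.μ r) _

/-- Vacuum off the slab: `f = 0` for `r ∉ [Rin, Rout]`. [folklore] -/
theorem f_eq_zero {r : ℝ} (hr : r ∉ Icc S.Rin S.Rout) (w L : ℝ) : S.f r w L = 0 :=
  Set.indicator_of_notMem hr _

/-- Vacuum off the slab: `ρ = 0` for `r ∉ [Rin, Rout]`. [folklore] -/
theorem ρ_eq_zero {r : ℝ} (hr : r ∉ Icc S.Rin S.Rout) : S.ρ r = 0 := Set.indicator_of_notMem hr _

/-- Vacuum off the slab: `p = 0` for `r ∉ [Rin, Rout]`. [folklore] -/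
theorem p_eq_zero {r : ℝ} (hr : r ∉ Icc S.Rin S.Rout) : S.p r = 0 := Set.indicator_of_notMem hr _

/-- Vacuum off the slab: `p_T = 0` for `r ∉ [Rin, Rout]`. [folklore] -/
theorem pT_eq_zero {r : ℝ} (hr : r ∉ Icc S.Rin S.Rout) : S.pT r = 0 := Set.indicator_of_notMem hr _

/-- The barrier at `Rin`: no particle there, `f(Rin, ·, ·) = 0`. [cite: Andreasson2021, §3] -/
theorem f_Rin (w : ℝ) {L : ℝ} (hL : 0 < L) : S.f S.Rin w L = 0 := by
  unfold f
  rw [Set.indicator_of_mem (left_mem_Icc.mpr S.Rin_lt_Rout.le)]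
  exact S.ansatz_Rin w L hL

/-- The barrier at `Rout`: no particle there, `f(Rout, ·, ·) = 0`. [cite: Andreasson2021, §3] -/
theorem f_Rout (w : ℝ) {L : ℝ} (hL : 0 < L) : S.f S.Rout w L = 0 := by
  unfold f
  rw [Set.indicator_of_mem (right_mem_Icc.mpr S.Rin_lt_Rout.le)]
  exact S.ansatz_Rout w L hL

/-- The matter quantities vanish at the inner radius: `ρ(Rin) = 0`. [cite: Andreasson2021, §3] -/
theorem ρ_Rin : S.ρ S.Rin = 0 := by
  unfold ρ
  rw [Set.indicator_of_mem (left_mem_Icc.mpr S.Rin_lt_Rout.le)]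
  exact energyDensity_eq_zero_of_forall S.ansatz_Rin

/-- `ρ(Rout) = 0`. [cite: Andreasson2021, Theorem 3.10 ("vanish at r = R₁")] -/
theorem ρ_Rout : S.ρ S.Rout = 0 := by
  unfold ρ
  rw [Set.indicator_of_mem (right_mem_Icc.mpr S.Rin_lt_Rout.le)]
  exact energyDensity_eq_zero_of_forall S.ansatz_Rout

/-- `p(Rin) = 0`. [cite: Andreasson2021, §4 ("p(R₀) = 0")] -/
theorem p_Rin : S.p S.Rin = 0 := by
  unfold p
  rw [Set.indicator_of_mem (left_mem_Icc.mpr S.Rin_lt_Rout.le)]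
  exact radialPressure_eq_zero_of_forall S.ansatz_Rin

/-- `p(Rout) = 0`. [cite: Andreasson2021, Theorem 3.10] -/
theorem p_Rout : S.p S.Rout = 0 := by
  unfold p
  rw [Set.indicator_of_mem (right_mem_Icc.mpr S.Rin_lt_Rout.le)]
  exact radialPressure_eq_zero_of_forall S.ansatz_Rout

/-- `p_T(Rin) = 0`. [folklore] -/
theorem pT_Rin : S.pT S.Rin = 0 := by
  unfold pT
  rw [Set.indicator_of_mem (left_mem_Icc.mpr S.Rin_lt_Rout.le)]
  exact tangentialPressure_eq_zero_of_forall S.ansatz_Rin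

/-- `p_T(Rout) = 0`. [folklore] -/
theorem pT_Rout : S.pT S.Rout = 0 := by
  unfold pT
  rw [Set.indicator_of_mem (right_mem_Icc.mpr S.Rin_lt_Rout.le)]
  exact tangentialPressure_eq_zero_of_forall S.ansatz_Rout

/-- **The shell matter is traceless: `ρ = p + 2 p_T` at every `r > 0`** (unconditionally: the
polytropic matter integrands are integrable). This is the "massless matter" relation `ρ = p + 2q` of
the ODE class of `CapacityLaw`. [cite: Andreasson2021, §4 ("p + 2p_T = ρ")] -/
theorem ρ_eq_p_add_two_mul_pT {r : ℝ} (hr : 0 < r) : S.ρ r = S.p r + 2 * S.pT r := by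
  by_cases h : r ∈ Icc S.Rin S.Rout
  · simp only [ρ, p, pT, Set.indicator_of_mem h]
    exact energyDensity_eq_radialPressure_add
      (integrableOn_sq_div_mul_phaseDensity S.E₀_pos S.L₀_pos S.k_nonneg
        (le_trans (by norm_num) S.half_le_l) S.μ hr)
      (integrableOn_div_mul_phaseDensity S.E₀_pos S.L₀_pos S.k_nonneg
        (le_trans (by norm_num) S.half_le_l) S.μ hr)
  · simp [S.ρ_eq_zero h, S.p_eq_zero h, S.pT_eq_zero h]

/-- `m` is non-decreasing on the black-hole exterior `r > 2M₀` (`m' = 4πr²ρ ≥ 0`). [folklore] -/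
theorem monotoneOn_m : MonotoneOn S.m (Ioi (2 * M₀)) := by
  refine monotoneOn_of_hasDerivWithinAt_nonneg (f' := fun r ↦ 4 * π * r ^ 2 * S.ρ r) (convex_Ioi _)
    (fun r hr ↦ (S.continuousAt_m hr).continuousWithinAt) ?_ ?_
  · rw [interior_Ioi]
    exact fun r hr ↦ (S.hasDerivAt_m' hr).hasDerivWithinAt
  · rw [interior_Ioi]
    exact fun r _ ↦ mul_nonneg (by positivity) (S.ρ_nonneg r)

/-- `m(Rin) = M₀`. [cite: Andreasson2021, §3] -/
theorem m_Rin : S.m S.Rin = M₀ := S.m_eq_of_le_Rin _ S.two_mul_lt_Rin le_rfl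

/-- `M₀ ≤ m(r)` on `r > 2M₀`. [folklore] -/
theorem le_m {r : ℝ} (hr : 2 * M₀ < r) : M₀ ≤ S.m r := by
  rcases le_total r S.Rin with h | h
  · exact (S.m_eq_of_le_Rin r hr h).ge
  · exact S.m_Rin.symm.le.trans (S.monotoneOn_m S.two_mul_lt_Rin hr h)

/-- `m > 0` on `r > 2M₀`. [folklore] -/
theorem m_pos {r : ℝ} (hr : 2 * M₀ < r) : 0 < S.m r := S.M₀_pos.trans_le (S.le_m hr)

/-- Beyond the slab the Hawking mass is constant, equal to the ADM mass: `m(r) = M` for `r ≥ Rout`.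
[cite: Andreasson2021, §3 (Schwarzschild solution glued at r = R₁)] -/
theorem m_eq_admMass {r : ℝ} (h : S.Rout ≤ r) : S.m r = S.admMass := by
  have hderiv : ∀ x ∈ Icc S.Rout r, HasDerivAt S.m 0 x := by
    intro x hx
    have hx2 : 2 * M₀ < x := S.two_mul_lt_Rout.trans_le hx.1
    have hρ : S.ρ x = 0 := by
      rcases hx.1.eq_or_lt with hx' | hx'
      · rw [← hx']; exact S.ρ_Rout
      · exact S.ρ_eq_zero fun hm ↦ (not_le.mpr hx') hm.2
    simpa [hρ] using S.hasDerivAt_m' hx2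
  exact constant_of_has_deriv_right_zero (fun x hx ↦ (hderiv x hx).continuousAt.continuousWithinAt)
    (fun x hx ↦ (hderiv x (Ico_subset_Icc_self hx)).hasDerivWithinAt) r (right_mem_Icc.mpr h)

/-- `m(r) → M` as `r → ∞` (the ADM mass is the total mass). [folklore] -/
theorem tendsto_m : Tendsto S.m atTop (𝓝 S.admMass) :=
  tendsto_const_nhds.congr' <|
    (eventually_ge_atTop S.Rout).mono fun _ hr ↦ (S.m_eq_admMass hr).symm

/-- `M₀ ≤ M`: the shell adds mass. [folklore] -/
theorem le_admMass : M₀ ≤ S.admMass := S.le_m S.two_mul_lt_Rout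

/-- `M > 0`. [folklore] -/
theorem admMass_pos : 0 < S.admMass := S.M₀_pos.trans_le S.le_admMass

/-- No horizon at the outer edge: `2M < Rout`. [folklore] -/
theorem two_mul_admMass_lt_Rout : 2 * S.admMass < S.Rout := S.two_mul_m_lt _ S.two_mul_lt_Rout

/-- `η ≥ 0`. [folklore] -/
theorem massFraction_nonneg : 0 ≤ S.massFraction := by
  unfold massFraction
  rw [sub_nonneg, le_div_iff₀ S.M₀_pos, one_mul]
  exact S.le_admMass

/-- `M = M₀ (1 + η)`. [folklore] -/
theorem admMass_eq : S.admMass = M₀ * (1 + S.massFraction) := by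
  unfold massFraction
  field_simp [S.M₀_pos.ne']
  ring

/-- On the gap the `μ`-equation is the vacuum one: `μ' = M₀/(r(r - 2M₀))` for `2M₀ < r ≤ Rin`
(at `r = Rin` by the barrier, `p(Rin) = 0`).
[cite: Andreasson2021, §4 ("ρ = p = 0 and m(r) = M₀ for r ≤ R₀")] -/
theorem hasDerivAt_μ_of_le_Rin {r : ℝ} (h₁ : 2 * M₀ < r) (h₂ : r ≤ S.Rin) :
    HasDerivAt S.μ (M₀ / (r * (r - 2 * M₀))) r := by
  have hp : S.p r = 0 := by
    rcases h₂.lt_or_eq with h | h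
    · exact S.p_eq_zero fun hm ↦ (not_le.mpr h) hm.1
    · rw [h]; exact S.p_Rin
  have := S.hasDerivAt_μ' h₁
  rwa [hp, S.m_eq_of_le_Rin r h₁ h₂, mul_zero, add_zero] at this

/-- Outside the slab the `μ`-equation is the vacuum one: `μ' = M/(r(r - 2M))` for `r ≥ Rout`
(at `r = Rout` by the barrier, `p(Rout) = 0`). [cite: Andreasson2021, §3] -/
theorem hasDerivAt_μ_of_Rout_le {r : ℝ} (h : S.Rout ≤ r) :
    HasDerivAt S.μ (S.admMass / (r * (r - 2 * S.admMass))) r := by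
  have hp : S.p r = 0 := by
    rcases h.lt_or_eq with h' | h'
    · exact S.p_eq_zero fun hm ↦ (not_le.mpr h') hm.2
    · rw [← h']; exact S.p_Rout
  have := S.hasDerivAt_μ' (S.two_mul_lt_Rout.trans_le h)
  rwa [hp, S.m_eq_admMass h, mul_zero, add_zero] at this

/-- Integration of the vacuum `μ`-equation: if `μ' = M/(x(x - 2M))` and `2M < x` on `[a, b]`, then
`μ - ½ log (1 - 2M/·)` is constant on `[a, b]`. [folklore] -/
theorem sub_log_eq_of_hasDerivAt {μ : ℝ → ℝ} {M a b : ℝ} (ha : 2 * M < a) (h0 : 0 < a)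
    (hμ : ∀ x ∈ Icc a b, HasDerivAt μ (M / (x * (x - 2 * M))) x) {x : ℝ} (hx : x ∈ Icc a b) :
    μ x - 1 / 2 * Real.log (1 - 2 * M / x) = μ a - 1 / 2 * Real.log (1 - 2 * M / a) := by
  have hψ : ∀ y ∈ Icc a b, HasDerivAt (fun z ↦ μ z - 1 / 2 * Real.log (1 - 2 * M / z)) 0 y := by
    intro y hy
    have hy0 : 0 < y := h0.trans_le hy.1
    have hy2 : y - 2 * M ≠ 0 := by linarith [hy.1]
    have hy1 : 1 - 2 * M / y ≠ 0 := by
      rw [sub_ne_zero, ne_comm, ne_eq, div_eq_one_iff_eq hy0.ne']; linarith [hy.1]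
    have h1 : HasDerivAt (fun z ↦ 1 - 2 * M / z) (-((0 * y - 2 * M * 1) / y ^ 2)) y :=
      (((hasDerivAt_const y (2 * M)).div (hasDerivAt_id y) hy0.ne')).const_sub 1
    refine ((hμ y hy).sub ((h1.log hy1).const_mul (1 / 2))).congr_deriv ?_
    rw [sub_eq_zero]
    field_simp
    ring
  exact constant_of_has_deriv_right_zero (fun y hy ↦ (hψ y hy).continuousAt.continuousWithinAt)
    (fun y hy ↦ (hψ y (Ico_subset_Icc_self hy)).hasDerivWithinAt) x hx

/-- **The gap is Schwarzschild of mass `M₀` in standard form:** `e^{2μ(r)} = 1 - 2M₀/r` for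
`2M₀ < r ≤ Rin`. [cite: Andreasson2021, §3 ("in a vacuum region in the exterior of the black hole it
holds that e^{2μ(r)} = 1 - 2M₀/r")] -/
theorem exp_two_mul_μ_of_le_Rin {r : ℝ} (h₁ : 2 * M₀ < r) (h₂ : r ≤ S.Rin) :
    Real.exp (2 * S.μ r) = 1 - 2 * M₀ / r := by
  have hr0 : 0 < r := lt_trans (by linarith [S.M₀_pos]) h₁
  have hpos : 0 < 1 - 2 * M₀ / r := by rw [sub_pos, div_lt_one hr0]; exact h₁
  have hRin : S.μ S.Rin - 1 / 2 * Real.log (1 - 2 * M₀ / S.Rin) = 0 := by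
    rw [← S.exp_two_mul_μ_Rin, Real.log_exp]; ring
  have h := sub_log_eq_of_hasDerivAt (μ := S.μ) (b := S.Rin) h₁ hr0
    (fun x hx ↦ S.hasDerivAt_μ_of_le_Rin (h₁.trans_le hx.1) hx.2) (right_mem_Icc.mpr h₂)
  rw [hRin] at h
  have hμ : 2 * S.μ r = Real.log (1 - 2 * M₀ / r) := by linarith
  rw [hμ, Real.exp_log hpos]

/-- The redshift constant `μ∞ := μ(Rout) - ½ log (1 - 2M/Rout)` (`= lim_{r→∞} μ(r)`, `tendsto_μ`).
[cite: Andreasson2021, Remark 3.6 ("μ(r) has a finite limit μ(∞)")] -/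
def μInfty : ℝ := S.μ S.Rout - 1 / 2 * Real.log (1 - 2 * S.admMass / S.Rout)

/-- **The exterior is Schwarzschild of mass `M = admMass`:** `e^{2(μ(r) - μ∞)} = 1 - 2M/r` for
`r ≥ Rout` (so `μ - μ∞` is the asymptotically flat potential of Remark 3.6, and the ADM mass of the
spacetime is `admMass`). [cite: Andreasson2021, §3 (Schwarzschild solution glued at R₁), Remark 3.6] -/
theorem exp_two_mul_μ_sub_μInfty {r : ℝ} (h : S.Rout ≤ r) :
    Real.exp (2 * (S.μ r - S.μInfty)) = 1 - 2 * S.admMass / r := by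
  have hr0 : 0 < r := S.Rout_pos.trans_le h
  have hpos : 0 < 1 - 2 * S.admMass / r := by
    rw [sub_pos, div_lt_one hr0]; linarith [S.two_mul_admMass_lt_Rout]
  have h' := sub_log_eq_of_hasDerivAt (μ := S.μ) (b := r) S.two_mul_admMass_lt_Rout S.Rout_pos
    (fun x hx ↦ S.hasDerivAt_μ_of_Rout_le hx.1) (right_mem_Icc.mpr h)
  have hμ : 2 * (S.μ r - S.μInfty) = Real.log (1 - 2 * S.admMass / r) := by
    unfold μInfty; linarith
  rw [hμ, Real.exp_log hpos]

/-- Explicit exterior potential: `μ(r) = μ∞ + ½ log (1 - 2M/r)` for `r ≥ Rout`. [folklore] -/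
theorem μ_eq_of_Rout_le {r : ℝ} (h : S.Rout ≤ r) :
    S.μ r = S.μInfty + 1 / 2 * Real.log (1 - 2 * S.admMass / r) := by
  have h' := sub_log_eq_of_hasDerivAt (μ := S.μ) (b := r) S.two_mul_admMass_lt_Rout S.Rout_pos
    (fun x hx ↦ S.hasDerivAt_μ_of_Rout_le hx.1) (right_mem_Icc.mpr h)
  unfold μInfty; linarith

/-- `μ(r) → μ∞` as `r → ∞` (Remark 3.6: "`μ(r)` has a finite limit `μ(∞)`"; `λ → 0` likewise since
`m` is eventually constant). [cite: Andreasson2021, Remark 3.6] -/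
theorem tendsto_μ : Tendsto S.μ atTop (𝓝 S.μInfty) := by
  have hc : Tendsto (fun _ : ℝ ↦ (1 : ℝ)) atTop (𝓝 1) := tendsto_const_nhds
  have hd : Tendsto (fun y : ℝ ↦ 2 * S.admMass / y) atTop (𝓝 0) :=
    tendsto_const_nhds.div_atTop tendsto_id
  have h1 : Tendsto (fun y : ℝ ↦ 1 - 2 * S.admMass / y) atTop (𝓝 1) := by
    simpa using hc.sub hd
  have h2 : Tendsto (fun y : ℝ ↦ Real.log (1 - 2 * S.admMass / y)) atTop (𝓝 0) := by
    simpa [Real.log_one] using h1.log one_ne_zero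
  have h3 : Tendsto (fun y : ℝ ↦ S.μInfty + 1 / 2 * Real.log (1 - 2 * S.admMass / y)) atTop
      (𝓝 S.μInfty) := by
    rw [show 𝓝 S.μInfty = 𝓝 (S.μInfty + 1 / 2 * 0) by norm_num]
    exact (h2.const_mul (1 / 2)).const_add S.μInfty
  exact h3.congr' <| (eventually_ge_atTop S.Rout).mono fun r hr ↦ (S.μ_eq_of_Rout_le hr).symm

end StaticMasslessVlasovShell

/-- **Andréasson 2021, existence of massless Vlasov shells around a Schwarzschild black hole**
(Theorem 3.5, proved via Theorem 3.10 for the ansatz (2.9) with `k = 0`, `l = 1/2`): for every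
black-hole mass `M₀ > 0` there is a static spherically symmetric solution of the massless
Einstein–Vlasov system surrounding the black hole, with finite ADM mass, matter supported in a slab
`[R₀, R₁]` with `R₀ > 3M₀`, and asymptotically flat (after the rescaling of Remark 3.6) — in the
vocabulary of this file (which keeps the paper's normalisation "data given at `r = R₀`" of
Theorem 3.10), a `StaticMasslessVlasovShell M₀` with `k = 0`, `l = 1/2` carrying matter
(`M₀ < admMass`). (The paper also allows `M₀ = 0` and, Remark 3.9, any finite number of nested
shells; not recorded here.)
Named fact, not proved in this file. [cite: Andreasson2021, Theorem 3.5 and Theorem 3.10] -/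
def Andreasson2021_shellExistence : Prop :=
  ∀ M₀ : ℝ, 0 < M₀ →
    ∃ S : StaticMasslessVlasovShell M₀, S.k = 0 ∧ S.l = 1 / 2 ∧ M₀ < S.admMass

end Literature.Geometry.Lorentzian

end
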